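import Mathlib.AlgebraicGeometry.EllipticCurve.DivisionPolynomial.Degree
import Mathlib.AlgebraicGeometry.EllipticCurve.VariableChange
import Mathlib.Algebra.Polynomial.Reverse
import Summits.BirchSwinnertonDyer.Rank1Residual.GaloisImage.QuarticKummerThreeAdicHensel
import HarnessLib

/-!
# Roots of the `3`-division quartic `Ψ₃` in the Kummer field `K₄ = ℚ₃(3^{1/4})`
# (cell `b2b-bsdres`, team n1011, row T-SSQ3, seat n1011-p05 GEN 11, FILE F2 — class-free TOOL)

HONEST FRAMING (cell `b2b-bsdres`, run/shared/lean/b2b/bsd-rank1-residual/, verbatim in every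
file): the goal of the cell is to DELETE the COMBINATION-SHAPED residual classes of the
Birch–Swinnerton-Dyer formula for ALL analytic-rank `≤ 1` elliptic curves over `ℚ` — "full BSD
formula for every rank `≤ 1` curve in class `C`" assembled STRICTLY from published theorems — so
that the rank-`≤ 1` remainder becomes exactly the CONSTRUCTION-SHAPED classes, which are TYPED
(missing-input `Prop`s), NOT attempted. This is not "finishing BSD". Team n1011; row T-SSQ3
(`cells/n1011/skel/T-SSQ3.md`) = a KERNEL proof of the O5 cell's node T19a
`O5.SupersingularLocalClassUniqueThree`. This file: TOOL theorems only — no definition, no named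
fact, no `sorry`; nothing about any particular curve; nothing booked.

## What

`Ψ₃ = 3x⁴ + b₂x³ + 3b₄x² + 3b₆x + b₈` (Mathlib `WeierstrassCurve.Ψ₃`). With `K₄ = ℚ₃(ϖ)`, `ϖ⁴ = 3`
(`AdjoinRoot (X ^ 4 - C 3)` over `ℚ_[3]`, FILE F1 `QuarticKummerThreeAdicHensel`):

* §1 `Ψ₃_smul_comp` — the `3`-division quartic under a change of Weierstrass model:
  `(C • W).Ψ₃ ∘ (u⁻²(X − r)) = u⁻⁸ · W.Ψ₃` (any commutative ring); hence over a field the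
  transports `exists_isRoot_Ψ₃_smul_iff` (rootlessness), `aeval_Ψ₃_smul_eq_zero` (roots in any
  algebra, e.g. `K₄`) and `irreducible_Ψ₃_smul_iff`.
* §2 `irreducible_of_irreducible_reverse` — over a field, a polynomial with non-zero constant term
  is irreducible if its reverse is.
* §2 `coeff_quartic` / `natDegree_quartic` / `isEisensteinAt_quartic` — Eisenstein's criterion for an
  explicit quartic `a₄X⁴ + … + a₀`.
* §3 `Ψ₃_eq_quartic`, `coeff_Ψ₃_zero = b₈`, `reverse_Ψ₃ = b₈y⁴ + 3b₆y³ + 3b₄y² + b₂y + 3`.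
* §4 `K₄` as a `ℤ₃`-algebra: `charZero_kummerField`, `algebraMap_padicInt_kummerField`, and
  `aeval_Ψ₃_map` (the value of `Ψ₃` of a `ℤ₃`-model at a point of `K₄`).

The two SHAPES on which `Ψ₃` is irreducible with a root in `K₄` (good supersingular: `3 ∣ b₂`,
`b₈ ≡ −1`; `III*`: `27 ∣ b₂, 27 ∣ b₄, 81 ∣ b₆, b₈ = 3⁶β₈, β₈ ≡ −1`) are the sibling FILE F2b
`GaloisImage/PsiThreeKummerQuarticShapes.lean`.

References: J.-P. Serre, Invent. Math. 15 (1972) §1.11 (the tame inertia on `E[p]` at a supersingular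
prime; here only as motivation) [Serre1972]; J. H. Silverman, *AEC* III.1 (change of variables),
Ex. 3.7 (`ψ₃`) [SilvermanAEC2009]; cells/n1011/skel/T-SSQ3.md.
-/

noncomputable section

open Polynomial

namespace Summit.BirchSwinnertonDyer.Rank1Residual.GaloisImage.PsiThreeKummer

open Summit.BirchSwinnertonDyer.Rank1Residual.GaloisImage.QuarticKummerThree

/-! ## §1 `Ψ₃` under a change of Weierstrass model -/

section VariableChange

variable {R : Type*} [CommRing R] (W : WeierstrassCurve R) (C : WeierstrassCurve.VariableChange R)

/-- **`Ψ₃` under a change of model**: `(C • W).Ψ₃ (u⁻²(X − r)) = u⁻⁸ · W.Ψ₃(X)` (the roots of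
`Ψ₃` are the `x`-coordinates of the `3`-torsion points, `x = u²x' + r`). [cite: SilvermanAEC2009, III.1 (Table 3.1) and Exercise 3.7] -/
theorem Ψ₃_smul_comp :
    (C • W).Ψ₃.comp (Polynomial.C (((C.u⁻¹ : Rˣ) : R) ^ 2) * (X - Polynomial.C C.r)) =
      Polynomial.C (((C.u⁻¹ : Rˣ) : R) ^ 8) * W.Ψ₃ := by
  simp only [WeierstrassCurve.Ψ₃, WeierstrassCurve.variableChange_b₂,
    WeierstrassCurve.variableChange_b₄, WeierstrassCurve.variableChange_b₆,
    WeierstrassCurve.variableChange_b₈, add_comp, mul_comp, pow_comp, X_comp, C_comp, ofNat_comp,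
    map_add, map_mul, map_pow, map_ofNat]
  ring

variable {A : Type*} [CommRing A] [Algebra R A]

/-- A root `y` of `W.Ψ₃` in an `R`-algebra gives the root `u⁻²(y − r)` of `(C • W).Ψ₃`. [folklore] -/
theorem aeval_Ψ₃_smul_eq_zero {y : A} (hy : aeval y W.Ψ₃ = 0) :
    aeval (algebraMap R A (((C.u⁻¹ : Rˣ) : R) ^ 2) * (y - algebraMap R A C.r)) (C • W).Ψ₃ = 0 := by
  have h := congrArg (aeval y) (Ψ₃_smul_comp W C)
  simp only [aeval_comp, map_mul, map_sub, map_pow, aeval_C, aeval_X, hy, mul_zero] at h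
  simpa only [map_pow] using h

/-- Conversely, a root `x` of `(C • W).Ψ₃` gives the root `u²x + r` of `W.Ψ₃`. [folklore] -/
theorem aeval_Ψ₃_eq_zero_of_smul {x : A} (hx : aeval x (C • W).Ψ₃ = 0) :
    aeval (algebraMap R A ((C.u : R) ^ 2) * x + algebraMap R A C.r) W.Ψ₃ = 0 := by
  have h := aeval_Ψ₃_smul_eq_zero (C • W) C⁻¹ hx
  rw [inv_smul_smul] at h
  have hu : algebraMap R A (C.u : R) * algebraMap R A ((C.u⁻¹ : Rˣ) : R) = 1 := by
    rw [← map_mul, Units.mul_inv, map_one]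
  have key : algebraMap R A (((C⁻¹.u⁻¹ : Rˣ) : R) ^ 2) * (x - algebraMap R A C⁻¹.r) =
      algebraMap R A ((C.u : R) ^ 2) * x + algebraMap R A C.r := by
    simp only [WeierstrassCurve.VariableChange.inv_def, inv_inv, map_pow, map_neg, map_mul]
    linear_combination ((algebraMap R A C.r) *
      (algebraMap R A (C.u : R) * algebraMap R A ((C.u⁻¹ : Rˣ) : R) + 1)) * hu
  rwa [key] at h

end VariableChange

section Field

variable {K : Type*} [Field K] (W : WeierstrassCurve K) (C : WeierstrassCurve.VariableChange K)

/-- **Rootlessness of `Ψ₃` over the base field is model-independent.** [folklore] -/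
theorem forall_not_isRoot_Ψ₃_smul_iff :
    (∀ x : K, ¬ (C • W).Ψ₃.IsRoot x) ↔ ∀ y : K, ¬ W.Ψ₃.IsRoot y := by
  constructor
  · intro h y hy
    have := aeval_Ψ₃_smul_eq_zero W C (A := K) (y := y) (by rwa [coe_aeval_eq_eval])
    rw [coe_aeval_eq_eval] at this
    exact h _ this
  · intro h x hx
    have := aeval_Ψ₃_eq_zero_of_smul W C (A := K) (x := x) (by rwa [coe_aeval_eq_eval])
    rw [coe_aeval_eq_eval] at this
    exact h _ this

/-- **Irreducibility of `Ψ₃` over the base field is model-independent**: composing with the affine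
substitution `X ↦ u⁻²(X − r)` is an automorphism of `K[X]`, and `u⁻⁸` is a unit. [folklore] -/
theorem irreducible_Ψ₃_smul_iff : Irreducible (C • W).Ψ₃ ↔ Irreducible W.Ψ₃ := by
  set v : K := ((C.u⁻¹ : Kˣ) : K) with hv
  have hv0 : v ^ 2 ≠ 0 := pow_ne_zero _ (Units.ne_zero _)
  letI : Invertible (v ^ 2) := invertibleOfNonzero hv0
  have hcomp : algEquivCMulXAddC (v ^ 2) (-(v ^ 2 * C.r)) (C • W).Ψ₃ =
      Polynomial.C (v ^ 8) * W.Ψ₃ := by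
    rw [algEquivCMulXAddC_apply, ← comp_eq_aeval, ← Ψ₃_smul_comp W C, ← hv, map_neg, map_mul,
      mul_sub, sub_eq_add_neg]
  have hunit : IsUnit (Polynomial.C (v ^ 8)) :=
    isUnit_C.mpr (pow_ne_zero _ (Units.ne_zero _)).isUnit
  have key : Irreducible (algEquivCMulXAddC (v ^ 2) (-(v ^ 2 * C.r)) (C • W).Ψ₃) ↔
      Irreducible (C • W).Ψ₃ := MulEquiv.irreducible_iff _
  rw [← key, hcomp, irreducible_isUnit_mul hunit]

end Field

/-! ## §2 Reversal and an Eisenstein helper -/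

section Reverse

variable {K : Type*} [Field K]

/-- Over a field, a polynomial with non-zero constant term whose reverse is a unit is a unit.
[folklore] -/
theorem isUnit_of_isUnit_reverse {g : K[X]} (hg0 : g.coeff 0 ≠ 0) (hu : IsUnit g.reverse) :
    IsUnit g := by
  have htd : g.natTrailingDegree = 0 := by
    by_contra h
    exact hg0 (coeff_eq_zero_of_lt_natTrailingDegree (Nat.pos_of_ne_zero h))
  have hdeg : g.natDegree = 0 := by
    rw [natDegree_eq_reverse_natDegree_add_natTrailingDegree g, natDegree_eq_zero_of_isUnit hu, htd]
  rw [eq_C_of_natDegree_eq_zero hdeg]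
  exact isUnit_C.mpr (IsUnit.mk0 _ hg0)

/-- **Over a field, a polynomial with non-zero constant term is irreducible if its reverse is.**
[folklore] -/
theorem irreducible_of_irreducible_reverse {f : K[X]} (h0 : f.coeff 0 ≠ 0)
    (hf : Irreducible f.reverse) : Irreducible f := by
  refine ⟨fun hu ↦ hf.not_isUnit ?_, fun g h hgh ↦ ?_⟩
  · rw [eq_C_of_natDegree_eq_zero (natDegree_eq_zero_of_isUnit hu), reverse, natDegree_C,
      reflect_C, pow_zero, mul_one]
    exact isUnit_C.mpr (IsUnit.mk0 _ h0)
  · have hrev : f.reverse = g.reverse * h.reverse := by rw [hgh, reverse_mul_of_domain]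
    have h0' : g.coeff 0 * h.coeff 0 ≠ 0 := by rwa [← mul_coeff_zero, ← hgh]
    rcases hf.isUnit_or_isUnit hrev with hg | hh
    · exact Or.inl (isUnit_of_isUnit_reverse (left_ne_zero_of_mul h0') hg)
    · exact Or.inr (isUnit_of_isUnit_reverse (right_ne_zero_of_mul h0') hh)

end Reverse

section Quartic

variable {R : Type*} [CommRing R]

/-- The coefficients of an explicit quartic `a₄X⁴ + a₃X³ + a₂X² + a₁X + a₀`. [folklore] -/
theorem coeff_quartic (a₀ a₁ a₂ a₃ a₄ : R) (n : ℕ) :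
    (Polynomial.C a₄ * X ^ 4 + Polynomial.C a₃ * X ^ 3 + Polynomial.C a₂ * X ^ 2 +
        Polynomial.C a₁ * X + Polynomial.C a₀).coeff n =
      if n = 4 then a₄ else if n = 3 then a₃ else if n = 2 then a₂ else if n = 1 then a₁
        else if n = 0 then a₀ else 0 := by
  simp only [coeff_add, coeff_C_mul, coeff_X_pow, coeff_X, coeff_C, mul_ite, mul_one, mul_zero]
  rcases Nat.lt_or_ge n 5 with hn | hn
  · interval_cases n <;> simp
  · simp [show n ≠ 4 by omega, show n ≠ 3 by omega, show n ≠ 2 by omega, show n ≠ 1 by omega,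
      show n ≠ 0 by omega, show (1:ℕ) ≠ n by omega]

/-- An explicit quartic with `a₄ ≠ 0` has degree `4`. [folklore] -/
theorem natDegree_quartic {a₀ a₁ a₂ a₃ a₄ : R} (ha : a₄ ≠ 0) :
    (Polynomial.C a₄ * X ^ 4 + Polynomial.C a₃ * X ^ 3 + Polynomial.C a₂ * X ^ 2 +
        Polynomial.C a₁ * X + Polynomial.C a₀).natDegree = 4 := by
  apply natDegree_eq_of_le_of_coeff_ne_zero
  · compute_degree
  · rwa [coeff_quartic, if_pos rfl]

/-- The leading coefficient of an explicit quartic with `a₄ ≠ 0`. [folklore] -/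
theorem leadingCoeff_quartic {a₀ a₁ a₂ a₃ a₄ : R} (ha : a₄ ≠ 0) :
    (Polynomial.C a₄ * X ^ 4 + Polynomial.C a₃ * X ^ 3 + Polynomial.C a₂ * X ^ 2 +
        Polynomial.C a₁ * X + Polynomial.C a₀).leadingCoeff = a₄ := by
  rw [leadingCoeff, natDegree_quartic ha, coeff_quartic, if_pos rfl]

/-- **Eisenstein for an explicit quartic**: `a₄ ∉ 𝓟`, `a₃, a₂, a₁, a₀ ∈ 𝓟`, `a₀ ∉ 𝓟²`.
[folklore] -/
theorem isEisensteinAt_quartic {𝓟 : Ideal R} {a₀ a₁ a₂ a₃ a₄ : R} (ha : a₄ ≠ 0) (h4 : a₄ ∉ 𝓟)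
    (h3 : a₃ ∈ 𝓟) (h2 : a₂ ∈ 𝓟) (h1 : a₁ ∈ 𝓟) (h0 : a₀ ∈ 𝓟) (h0' : a₀ ∉ 𝓟 ^ 2) :
    (Polynomial.C a₄ * X ^ 4 + Polynomial.C a₃ * X ^ 3 + Polynomial.C a₂ * X ^ 2 +
        Polynomial.C a₁ * X + Polynomial.C a₀).IsEisensteinAt 𝓟 := by
  refine ⟨by rwa [leadingCoeff_quartic ha], fun {n} hn ↦ ?_, by rwa [coeff_quartic, if_pos rfl]⟩
  rw [natDegree_quartic ha] at hn
  rw [coeff_quartic]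
  interval_cases n <;> simpa

end Quartic

/-! ## §3 The explicit forms of `Ψ₃`, its reverse and its scaling -/

section Explicit

variable {R : Type*} [CommRing R] (W : WeierstrassCurve R)

/-- `Ψ₃ = 3X⁴ + b₂X³ + 3b₄X² + 3b₆X + b₈` in the explicit-quartic normal form. [folklore] -/
theorem Ψ₃_eq_quartic : W.Ψ₃ = Polynomial.C 3 * X ^ 4 + Polynomial.C W.b₂ * X ^ 3 +
    Polynomial.C (3 * W.b₄) * X ^ 2 + Polynomial.C (3 * W.b₆) * X + Polynomial.C W.b₈ := by
  simp only [WeierstrassCurve.Ψ₃, map_mul, map_ofNat]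

/-- The constant term of `Ψ₃` is `b₈`. [folklore] -/
theorem coeff_Ψ₃_zero : W.Ψ₃.coeff 0 = W.b₈ := by
  rw [Ψ₃_eq_quartic, coeff_quartic]
  simp

/-- **The reverse of `Ψ₃` is `b₈y⁴ + 3b₆y³ + 3b₄y² + b₂y + 3`** (when `3 ≠ 0`). [folklore] -/
theorem reverse_Ψ₃ (h3 : (3 : R) ≠ 0) : W.Ψ₃.reverse = Polynomial.C W.b₈ * X ^ 4 +
    Polynomial.C (3 * W.b₆) * X ^ 3 + Polynomial.C (3 * W.b₄) * X ^ 2 + Polynomial.C W.b₂ * X +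
    Polynomial.C 3 := by
  have hΨ : W.Ψ₃ = Polynomial.C 3 * X ^ 4 + Polynomial.C W.b₂ * X ^ 3 +
      Polynomial.C (3 * W.b₄) * X ^ 2 + Polynomial.C (3 * W.b₆) * X ^ 1 +
      Polynomial.C W.b₈ * X ^ 0 := by
    rw [Ψ₃_eq_quartic, pow_one, pow_zero, mul_one]
  rw [reverse, W.natDegree_Ψ₃ h3, hΨ]
  simp only [reflect_add, reflect_C_mul_X_pow]
  rw [revAt_le (show 4 ≤ 4 by norm_num), revAt_le (show 3 ≤ 4 by norm_num),
    revAt_le (show 2 ≤ 4 by norm_num), revAt_le (show 1 ≤ 4 by norm_num),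
    revAt_le (show 0 ≤ 4 by norm_num)]
  norm_num
  ring

end Explicit

/-! ## §4 The Kummer field `K₄` as a `ℤ₃`-algebra -/

section KummerField

/-- `K₄ = ℚ₃(ϖ)` has characteristic zero. [folklore] -/
theorem charZero_kummerField : CharZero (AdjoinRoot (X ^ 4 - C (3 : ℚ_[3]))) := by
  haveI : Fact (Irreducible (X ^ 4 - C (3 : ℚ_[3]))) := ⟨irreducible_kummerQuartic⟩
  exact charZero_of_injective_algebraMap (algebraMap ℚ_[3] _).injective

/-- The structure map `ℤ₃ → K₄` is `ℤ₃ ⊂ ℚ₃ → K₄`. [folklore] -/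
theorem algebraMap_padicInt_kummerField (c : ℤ_[3]) :
    algebraMap ℤ_[3] (AdjoinRoot (X ^ 4 - C (3 : ℚ_[3]))) c =
      AdjoinRoot.of (X ^ 4 - C (3 : ℚ_[3])) (c : ℚ_[3]) := by
  rw [AdjoinRoot.algebraMap_eq', RingHom.comp_apply, PadicInt.algebraMap_apply]

/-- `aeval` on `K₄` of the base change to `ℚ₃` of a `ℤ₃`-model's `Ψ₃`. [folklore] -/
theorem aeval_Ψ₃_map (M : WeierstrassCurve ℤ_[3]) (x : AdjoinRoot (X ^ 4 - C (3 : ℚ_[3]))) :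
    aeval x (M.map (algebraMap ℤ_[3] ℚ_[3])).Ψ₃ =
      algebraMap ℤ_[3] _ 3 * x ^ 4 + algebraMap ℤ_[3] _ M.b₂ * x ^ 3 +
        algebraMap ℤ_[3] _ (3 * M.b₄) * x ^ 2 + algebraMap ℤ_[3] _ (3 * M.b₆) * x +
        algebraMap ℤ_[3] _ M.b₈ := by
  rw [WeierstrassCurve.map_Ψ₃, aeval_map_algebraMap, Ψ₃_eq_quartic]
  simp only [map_add, map_mul, aeval_C, aeval_X, map_pow]

end KummerField


end Summit.BirchSwinnertonDyer.Rank1Residual.GaloisImage.PsiThreeKummer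

end
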